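import Summits.NavierStokesRegularity.NavierStokesRegularity.Theorems.PalasekTowerBreakdownEpisodeBaseStrainPairingLevelTwo
import Literature.Analysis.FluidPDE.AncientMildWeak

/-!
# The strain-currency door at the `H¹` level: the slice inequality (time-free)

Cell `ns-blowup`, seat `ns-palasek-19179-p2` (g6; holder-of-record lineage of crux
stmt-NavierStokesRegularity-19179 `EpisodeBase`, route `PalasekTowerBreakdown`; `--supports
stmt-NavierStokesRegularity-19179`). Support for the stub `stub_strain_door : StrainDoor` of the strategist line
`Cruxes/EpisodeBase/Lines/straindoor.lean` (cstrat-19179, v2). LABEL: E–C analysis (KERNEL: theorems only; no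
definition, no named fact, no `sorry`; register-free — any finite-dimensional real inner product space `E`).
WHAT THIS IS NOT: not Navier–Stokes evidence — a slice inequality for given fields; no flow, run, design,
certificate or blow-up is exhibited or asserted; it does NOT prove `StrainDoor`.

THE STATEMENT (`neg_integral_inner_rhs_laplacian_le`). At a fixed time, let `u` (the reference slice) have bounded
derivatives, be divergence free, with the strain majorant `|⟪Du(x)ξ, ξ⟫| ≤ σ‖ξ‖²` and Hessian majorant `‖D(Du)‖ ≤ σ₂`;
let `W` (the difference slice) be a divergence-free smooth `L²` field with `‖W‖ ≤ m`; `π` (pressure difference) a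
smooth `L²` scalar; `r` (residual) a smooth `L²` field; and let `A` be the right-hand side of the difference equation,
`A = ΔW − [(W·∇)u + (u·∇)W + (W·∇)W] − ∇π − r` (so that `∂ₜW = A` along two classical runs). Then, with
`D₁ = ∑ₖ ∫‖∂ₖW‖²` and `D₂ = ∫‖ΔW‖²`,

  `−∫ ⟪A, ΔW⟫ ≤ −D₂ + 2σ D₁ + σ₂ ∫ ‖W‖ ∑ₖ‖∂ₖW‖ + m √(∫‖DW‖²) √D₂ + √(∑ₖ∫‖∂ₖr‖²) √D₁`,

which is the `H¹`-level formal derivative bound `½ d/dt D₁ = −∫⟪∂ₜW, ΔW⟫ ≤ …` of the door (card's rate `4σ` after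
doubling), with NO `‖u‖_∞`, NO `‖Du‖_∞`: dissipation `−D₂`; stretching and transport by Parts I/II
(`abs_integral_inner_convect_laplacian_le_of_strain(_of_hess)`); the cubic term by the sup bound `m` of `W` (the
door's bootstrap quantity, to be fed by the explicit Agmon inequality); the pressure term vanishes because `ΔW` is
divergence free (`isDivFree_laplacian_of_contDiff`, `IsSmoothL2Field.integral_inner_gradient`); the residual term after
Green's identity is `−∑ₖ∫⟪∂ₖr, ∂ₖW⟫` (finite Cauchy–Schwarz). Also: `opNorm_sq_le_sum_norm_apply_sq`
(`‖L‖² ≤ ∑ₖ ‖L bₖ‖²`) and `integral_norm_fderiv_sq_le_sum` (`∫‖DW‖² ≤ D₁`) to close the cubic term in `D₁`.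

References: P. Constantin, C. Foias, *Navier–Stokes Equations*, 1988, Ch. 10 [cite: ConstantinFoiasNSE1988, Ch. 10 Thm. 10.2];
M. Dashti, J. C. Robinson, SIAM J. Numer. Anal. 46 (2008), Thm. 5 [cite: DashtiRobinson2008, Thm. 5].
-/

noncomputable section

set_option linter.dupNamespace false

open MeasureTheory Filter Function Set
open scoped ENNReal NNReal RealInnerProductSpace Topology Laplacian
open Literature.Analysis.FunctionSpaces Literature.Analysis.FluidPDE

namespace Summit.NavierStokesRegularity.NavierStokesRegularity.Theorems.StrainPairing

variable {E : Type*} [NormedAddCommGroup E] [InnerProductSpace ℝ E] [FiniteDimensional ℝ E]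
  [MeasurableSpace E] [BorelSpace E]
variable {E' : Type*} [NormedAddCommGroup E'] [InnerProductSpace ℝ E'] [FiniteDimensional ℝ E']

/-! ## Tools: operator norm against the Frobenius sum; finite Cauchy–Schwarz for pairings -/

omit [FiniteDimensional ℝ E] [FiniteDimensional ℝ E'] [MeasurableSpace E] [BorelSpace E] in
/-- `‖L‖² ≤ ∑ₖ ‖L bₖ‖²` for an orthonormal basis `b` (operator norm against the Frobenius norm).
[cite: ConstantinFoiasNSE1988, Ch. 10 Thm. 10.2] -/
theorem opNorm_sq_le_sum_norm_apply_sq {ι : Type*} [Fintype ι] (b : OrthonormalBasis ι ℝ E) (L : E →L[ℝ] E') :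
    ‖L‖ ^ 2 ≤ ∑ k, ‖L (b k)‖ ^ 2 := by
  set S : ℝ := ∑ k, ‖L (b k)‖ ^ 2 with hS
  have hS0 : 0 ≤ S := Finset.sum_nonneg fun k _ => sq_nonneg _
  have hop : ‖L‖ ≤ Real.sqrt S := by
    refine ContinuousLinearMap.opNorm_le_bound _ (Real.sqrt_nonneg _) fun v => ?_
    have hv : L v = ∑ k, ⟪b k, v⟫ • L (b k) := by
      conv_lhs => rw [← b.sum_repr' v]
      simp only [map_sum, map_smul]
    have h1 : ‖L v‖ ≤ ∑ k, |⟪b k, v⟫| * ‖L (b k)‖ := by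
      rw [hv]
      refine (norm_sum_le _ _).trans (Finset.sum_le_sum fun k _ => ?_)
      rw [norm_smul, Real.norm_eq_abs]
    have h2 : (∑ k, |⟪b k, v⟫| * ‖L (b k)‖) ^ 2 ≤ (∑ k, |⟪b k, v⟫| ^ 2) * ∑ k, ‖L (b k)‖ ^ 2 :=
      Finset.sum_mul_sq_le_sq_mul_sq _ _ _
    have h3 : ∑ k, |⟪b k, v⟫| ^ 2 = ‖v‖ ^ 2 := by
      rw [← b.sum_sq_inner_right v]; exact Finset.sum_congr rfl fun k _ => sq_abs _
    rw [h3] at h2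
    have h4 : ∑ k, |⟪b k, v⟫| * ‖L (b k)‖ ≤ Real.sqrt S * ‖v‖ := by
      have hpos : 0 ≤ ∑ k, |⟪b k, v⟫| * ‖L (b k)‖ :=
        Finset.sum_nonneg fun k _ => mul_nonneg (abs_nonneg _) (norm_nonneg _)
      have hsq : (∑ k, |⟪b k, v⟫| * ‖L (b k)‖) ^ 2 ≤ (Real.sqrt S * ‖v‖) ^ 2 := by
        rw [mul_pow, Real.sq_sqrt hS0, mul_comm]; exact h2
      exact (pow_le_pow_iff_left₀ hpos (by positivity) two_ne_zero).1 hsq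
    exact h1.trans h4
  calc ‖L‖ ^ 2 ≤ (Real.sqrt S) ^ 2 := pow_le_pow_left₀ (norm_nonneg _) hop 2
    _ = S := Real.sq_sqrt hS0

/-- `∫ ‖DW‖²_op ≤ ∑ₖ ∫ ‖∂ₖW‖²` for a smooth `L²` field. [cite: ConstantinFoiasNSE1988, Ch. 10 Thm. 10.2] -/
theorem integral_norm_fderiv_sq_le_sum {W : E → E'} (hW : IsSmoothL2Field W) :
    ∫ x, ‖fderiv ℝ W x‖ ^ 2 ≤ ∑ k, ∫ x, ‖fderiv ℝ W x (stdOrthonormalBasis ℝ E k)‖ ^ 2 := by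
  set b := stdOrthonormalBasis ℝ E with hb
  have hsq : ∀ k, Integrable (fun x => ‖fderiv ℝ W x (b k)‖ ^ 2) volume := by
    intro k
    have := integrable_inner_of_memLp_two ((hW.fderiv_apply (b k)).memLp_two) ((hW.fderiv_apply (b k)).memLp_two)
    exact this.congr (Eventually.of_forall fun x => by simp only [real_inner_self_eq_norm_sq])
  have hop : Integrable (fun x => ‖fderiv ℝ W x‖ ^ 2) volume :=
    (memLp_two_iff_integrable_sq_norm (memLp_fderiv_two hW).1).1 (memLp_fderiv_two hW)
  rw [← integral_finsetSum _ fun k _ => hsq k]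
  exact integral_mono hop (integrable_finsetSum _ fun k _ => hsq k) fun x =>
    opNorm_sq_le_sum_norm_apply_sq b (fderiv ℝ W x)

omit [FiniteDimensional ℝ E'] in
/-- **Finite Cauchy–Schwarz for a sum of `L²` pairings**: `|∑ₖ ∫⟪fₖ, gₖ⟫| ≤ √(∑ₖ∫‖fₖ‖²) √(∑ₖ∫‖gₖ‖²)`.
[cite: ConstantinFoiasNSE1988, Ch. 10 Thm. 10.2] -/
theorem abs_sum_integral_inner_le_sqrt_mul_sqrt {ι : Type*} [Fintype ι] {f g : ι → E → E'}
    (hf : ∀ k, MemLp (f k) 2 volume) (hg : ∀ k, MemLp (g k) 2 volume) :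
    |∑ k, ∫ x, ⟪f k x, g k x⟫| ≤
      Real.sqrt (∑ k, ∫ x, ‖f k x‖ ^ 2) * Real.sqrt (∑ k, ∫ x, ‖g k x‖ ^ 2) := by
  -- each pairing by Cauchy–Schwarz, then the finite Cauchy–Schwarz inequality
  have hF0 : ∀ k, 0 ≤ ∫ x, ‖f k x‖ ^ 2 := fun k => integral_nonneg fun x => sq_nonneg _
  have hG0 : ∀ k, 0 ≤ ∫ x, ‖g k x‖ ^ 2 := fun k => integral_nonneg fun x => sq_nonneg _
  have hk : ∀ k, |∫ x, ⟪f k x, g k x⟫| ≤ Real.sqrt (∫ x, ‖f k x‖ ^ 2) * Real.sqrt (∫ x, ‖g k x‖ ^ 2) := by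
    intro k
    have h1 : |∫ x, ⟪f k x, g k x⟫| ≤ ∫ x, ‖f k x‖ * ‖g k x‖ :=
      (abs_integral_le_integral_abs).trans (integral_mono_of_nonneg (Eventually.of_forall fun x => abs_nonneg _)
        ((hf k).norm.integrable_mul (hg k).norm) (Eventually.of_forall fun x => abs_real_inner_le_norm _ _))
    have h2 := integral_mul_le_Lp_mul_Lq_of_nonneg (μ := (volume : Measure E)) Real.HolderConjugate.two_two
      (Eventually.of_forall fun x => norm_nonneg (f k x)) (Eventually.of_forall fun x => norm_nonneg (g k x))
      (by simpa using (hf k).norm) (by simpa using (hg k).norm)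
    refine h1.trans (h2.trans (le_of_eq ?_))
    rw [Real.sqrt_eq_rpow, Real.sqrt_eq_rpow]
    norm_num
  calc |∑ k, ∫ x, ⟪f k x, g k x⟫| ≤ ∑ k, |∫ x, ⟪f k x, g k x⟫| := Finset.abs_sum_le_sum_abs _ _
    _ ≤ ∑ k, Real.sqrt (∫ x, ‖f k x‖ ^ 2) * Real.sqrt (∫ x, ‖g k x‖ ^ 2) := Finset.sum_le_sum fun k _ => hk k
    _ ≤ Real.sqrt (∑ k, ∫ x, ‖f k x‖ ^ 2) * Real.sqrt (∑ k, ∫ x, ‖g k x‖ ^ 2) := by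
        have hcs := Finset.sum_mul_sq_le_sq_mul_sq Finset.univ
          (fun k => Real.sqrt (∫ x, ‖f k x‖ ^ 2)) (fun k => Real.sqrt (∫ x, ‖g k x‖ ^ 2))
        simp only [Real.sq_sqrt (hF0 _), Real.sq_sqrt (hG0 _)] at hcs
        have hpos : 0 ≤ ∑ k, Real.sqrt (∫ x, ‖f k x‖ ^ 2) * Real.sqrt (∫ x, ‖g k x‖ ^ 2) :=
          Finset.sum_nonneg fun k _ => mul_nonneg (Real.sqrt_nonneg _) (Real.sqrt_nonneg _)
        have hsq : (∑ k, Real.sqrt (∫ x, ‖f k x‖ ^ 2) * Real.sqrt (∫ x, ‖g k x‖ ^ 2)) ^ 2 ≤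
            (Real.sqrt (∑ k, ∫ x, ‖f k x‖ ^ 2) * Real.sqrt (∑ k, ∫ x, ‖g k x‖ ^ 2)) ^ 2 := by
          rw [mul_pow, Real.sq_sqrt (Finset.sum_nonneg fun k _ => hF0 k),
            Real.sq_sqrt (Finset.sum_nonneg fun k _ => hG0 k)]
          exact hcs
        exact (pow_le_pow_iff_left₀ hpos (by positivity) two_ne_zero).1 hsq

/-! ## The `H¹` slice inequality -/

/-- **The `H¹`-level slice inequality of the strain-currency door.** See the module docstring.
[cite: ConstantinFoiasNSE1988, Ch. 10 Thm. 10.2] [cite: DashtiRobinson2008, Thm. 5] -/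
theorem neg_integral_inner_rhs_laplacian_le {u W r A : E → E} {π : E → ℝ} {σ σ₂ m : ℝ}
    (hu : HasBoundedDerivs u) (hdiv : VectorCalculus.IsDivFree u)
    (hσ : ∀ x ξ : E, |⟪fderiv ℝ u x ξ, ξ⟫| ≤ σ * ‖ξ‖ ^ 2) (hσ₂ : ∀ x, ‖fderiv ℝ (fderiv ℝ u) x‖ ≤ σ₂)
    (hW : IsSmoothL2Field W) (hWdiv : VectorCalculus.IsDivFree W) (hm0 : 0 ≤ m) (hm : ∀ x, ‖W x‖ ≤ m)
    (hπ : IsSmoothL2Field π) (hr : IsSmoothL2Field r)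
    (hA : ∀ x, A x = (Δ W) x - (convect W u x + convect u W x + convect W W x) - gradient π x - r x) :
    -∫ x, ⟪A x, (Δ W) x⟫ ≤
      -(∫ x, ‖(Δ W) x‖ ^ 2) + 2 * σ * (∑ k, ∫ x, ‖fderiv ℝ W x (stdOrthonormalBasis ℝ E k)‖ ^ 2) +
        σ₂ * (∫ x, ‖W x‖ * ∑ k, ‖fderiv ℝ W x (stdOrthonormalBasis ℝ E k)‖) +
        m * Real.sqrt (∫ x, ‖fderiv ℝ W x‖ ^ 2) * Real.sqrt (∫ x, ‖(Δ W) x‖ ^ 2) +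
        Real.sqrt (∑ k, ∫ x, ‖fderiv ℝ r x (stdOrthonormalBasis ℝ E k)‖ ^ 2) *
          Real.sqrt (∑ k, ∫ x, ‖fderiv ℝ W x (stdOrthonormalBasis ℝ E k)‖ ^ 2) := by
  set b := stdOrthonormalBasis ℝ E with hb
  have hWB : HasBoundedDerivs W := hW.toHasBoundedDerivs
  have hΔ : IsSmoothL2Field (Δ W) := hW.laplacian
  have hΔ2 : MemLp (Δ W) 2 volume := hΔ.memLp_two
  -- integrability of the six pairings against `ΔW`
  have iΔ : Integrable (fun x => ⟪(Δ W) x, (Δ W) x⟫) volume := integrable_inner_of_memLp_two hΔ2 hΔ2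
  have iN₁ : Integrable (fun x => ⟪convect W u x, (Δ W) x⟫) volume := by
    obtain ⟨M₁, hM₁⟩ := hu.exists_norm_fderiv_le
    have hm1 : MemLp (convect W u) 2 volume := by
      refine MemLp.of_le_mul (c := M₁) hW.memLp_two ?_ (Eventually.of_forall fun x => ?_)
      · exact (((hu.contDiff_nat 1).continuous_fderiv one_ne_zero).clm_apply hW.continuous).aestronglyMeasurable
      · rw [convect_apply]
        exact (ContinuousLinearMap.le_opNorm _ _).trans (mul_le_mul_of_nonneg_right (hM₁ x) (norm_nonneg _))
    exact integrable_inner_of_memLp_two hm1 hΔ2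
  have iN₂ : Integrable (fun x => ⟪convect u W x, (Δ W) x⟫) volume :=
    integrable_inner_of_memLp_two (hW.convect hu).memLp_two hΔ2
  have iN₃ : Integrable (fun x => ⟪convect W W x, (Δ W) x⟫) volume :=
    integrable_inner_of_memLp_two (hW.convect hWB).memLp_two hΔ2
  have iπ : Integrable (fun x => ⟪gradient π x, (Δ W) x⟫) volume :=
    integrable_inner_of_memLp_two hπ.gradient.memLp_two hΔ2
  have ir : Integrable (fun x => ⟪r x, (Δ W) x⟫) volume := integrable_inner_of_memLp_two hr.memLp_two hΔ2
  -- values / bounds of the pairings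
  have vΔ : ∫ x, ⟪(Δ W) x, (Δ W) x⟫ = ∫ x, ‖(Δ W) x‖ ^ 2 :=
    integral_congr_ae (Eventually.of_forall fun x => real_inner_self_eq_norm_sq _)
  have vN₁ : ∫ x, ⟪convect W u x, (Δ W) x⟫ ≤
      σ * (∑ k, ∫ x, ‖fderiv ℝ W x (b k)‖ ^ 2) + σ₂ * ∫ x, ‖W x‖ * ∑ k, ‖fderiv ℝ W x (b k)‖ :=
    (le_abs_self _).trans (abs_integral_inner_convect_laplacian_le_of_strain_of_hess hu hW hσ hσ₂)
  have vN₂ : ∫ x, ⟪convect u W x, (Δ W) x⟫ ≤ σ * ∑ k, ∫ x, ‖fderiv ℝ W x (b k)‖ ^ 2 :=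
    (le_abs_self _).trans (abs_integral_inner_convect_laplacian_le_of_strain hu hdiv hW hσ)
  have vN₃ : ∫ x, ⟪convect W W x, (Δ W) x⟫ ≤
      m * Real.sqrt (∫ x, ‖fderiv ℝ W x‖ ^ 2) * Real.sqrt (∫ x, ‖(Δ W) x‖ ^ 2) := by
    have h1 : ∫ x, ⟪convect W W x, (Δ W) x⟫ ≤ ∫ x, (m * ‖fderiv ℝ W x‖) * ‖(Δ W) x‖ := by
      refine integral_mono iN₃ (((memLp_fderiv_two hW).norm.const_mul m).integrable_mul hΔ2.norm) fun x => ?_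
      refine (real_inner_le_norm _ _).trans (mul_le_mul_of_nonneg_right ?_ (norm_nonneg _))
      rw [convect_apply]
      calc ‖fderiv ℝ W x (W x)‖ ≤ ‖fderiv ℝ W x‖ * ‖W x‖ := ContinuousLinearMap.le_opNorm _ _
        _ ≤ ‖fderiv ℝ W x‖ * m := mul_le_mul_of_nonneg_left (hm x) (norm_nonneg _)
        _ = m * ‖fderiv ℝ W x‖ := mul_comm _ _
    have h2 : ∫ x, (m * ‖fderiv ℝ W x‖) * ‖(Δ W) x‖ = m * ∫ x, ‖fderiv ℝ W x‖ * ‖(Δ W) x‖ := by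
      rw [← integral_const_mul]; exact integral_congr_ae (Eventually.of_forall fun x => by ring)
    have h3 := integral_mul_le_Lp_mul_Lq_of_nonneg (μ := (volume : Measure E)) Real.HolderConjugate.two_two
      (Eventually.of_forall fun x => norm_nonneg (fderiv ℝ W x)) (Eventually.of_forall fun x => norm_nonneg ((Δ W) x))
      (by simpa using (memLp_fderiv_two hW).norm) (by simpa using hΔ2.norm)
    have h4 : (∫ x, ‖fderiv ℝ W x‖ ^ (2 : ℝ)) ^ (1 / (2 : ℝ)) * (∫ x, ‖(Δ W) x‖ ^ (2 : ℝ)) ^ (1 / (2 : ℝ)) =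
        Real.sqrt (∫ x, ‖fderiv ℝ W x‖ ^ 2) * Real.sqrt (∫ x, ‖(Δ W) x‖ ^ 2) := by
      rw [Real.sqrt_eq_rpow, Real.sqrt_eq_rpow]; norm_num
    rw [h4] at h3
    calc ∫ x, ⟪convect W W x, (Δ W) x⟫ ≤ m * ∫ x, ‖fderiv ℝ W x‖ * ‖(Δ W) x‖ := h1.trans h2.le
      _ ≤ m * (Real.sqrt (∫ x, ‖fderiv ℝ W x‖ ^ 2) * Real.sqrt (∫ x, ‖(Δ W) x‖ ^ 2)) :=
          mul_le_mul_of_nonneg_left h3 hm0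
      _ = _ := by ring
  have vπ : ∫ x, ⟪gradient π x, (Δ W) x⟫ = 0 := by
    have hcomm : ∫ x, ⟪gradient π x, (Δ W) x⟫ = ∫ x, ⟪(Δ W) x, gradient π x⟫ :=
      integral_congr_ae (Eventually.of_forall fun x => real_inner_comm _ _)
    have hΔdiv : VectorCalculus.IsDivFree (Δ W) := isDivFree_laplacian_of_contDiff (hW.contDiff_nat 3) hWdiv
    rw [hcomm, hΔ.integral_inner_gradient hπ]
    simp only [hΔdiv _, zero_mul, integral_zero, neg_zero]
  have vr : ∫ x, ⟪r x, (Δ W) x⟫ ≤ Real.sqrt (∑ k, ∫ x, ‖fderiv ℝ r x (b k)‖ ^ 2) *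
      Real.sqrt (∑ k, ∫ x, ‖fderiv ℝ W x (b k)‖ ^ 2) := by
    rw [integral_inner_laplacian_eq_neg_sum hr hW]
    refine (neg_le_abs _).trans ?_
    exact abs_sum_integral_inner_le_sqrt_mul_sqrt (fun k => hr.memLp_fderiv_apply (b k))
      (fun k => hW.memLp_fderiv_apply (b k))
  -- split the integral
  have hpt : ∀ x, ⟪A x, (Δ W) x⟫ = ⟪(Δ W) x, (Δ W) x⟫ -
      (⟪convect W u x, (Δ W) x⟫ + ⟪convect u W x, (Δ W) x⟫ + ⟪convect W W x, (Δ W) x⟫) -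
        ⟪gradient π x, (Δ W) x⟫ - ⟪r x, (Δ W) x⟫ := by
    intro x
    rw [hA x]
    simp only [inner_sub_left, inner_add_left]
  have i12 : Integrable (fun x => ⟪convect W u x, (Δ W) x⟫ + ⟪convect u W x, (Δ W) x⟫) volume := iN₁.add iN₂
  have i3 : Integrable (fun x => ⟪convect W u x, (Δ W) x⟫ + ⟪convect u W x, (Δ W) x⟫ + ⟪convect W W x, (Δ W) x⟫)
      volume := i12.add iN₃
  have i2 : Integrable (fun x => ⟪(Δ W) x, (Δ W) x⟫ -
      (⟪convect W u x, (Δ W) x⟫ + ⟪convect u W x, (Δ W) x⟫ + ⟪convect W W x, (Δ W) x⟫)) volume := iΔ.sub i3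
  have i1 : Integrable (fun x => ⟪(Δ W) x, (Δ W) x⟫ -
      (⟪convect W u x, (Δ W) x⟫ + ⟪convect u W x, (Δ W) x⟫ + ⟪convect W W x, (Δ W) x⟫) -
        ⟪gradient π x, (Δ W) x⟫) volume := i2.sub iπ
  have hsplit : ∫ x, ⟪A x, (Δ W) x⟫ = (∫ x, ⟪(Δ W) x, (Δ W) x⟫) -
      ((∫ x, ⟪convect W u x, (Δ W) x⟫) + (∫ x, ⟪convect u W x, (Δ W) x⟫) + ∫ x, ⟪convect W W x, (Δ W) x⟫) -
        (∫ x, ⟪gradient π x, (Δ W) x⟫) - ∫ x, ⟪r x, (Δ W) x⟫ := by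
    simp_rw [hpt]
    rw [integral_sub i1 ir, integral_sub i2 iπ, integral_sub iΔ i3, integral_add i12 iN₃, integral_add iN₁ iN₂]
  rw [hsplit, vΔ, vπ]
  linarith [vN₁, vN₂, vN₃, vr]

end Summit.NavierStokesRegularity.NavierStokesRegularity.Theorems.StrainPairing

end
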